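import Summits.Schanuel.Schanuel.Theorems.ZilberEacIrrationalPhaseBranch
import Summits.Schanuel.Schanuel.Theorems.ZilberEacGraphCurveInstances
import Summits.Schanuel.Schanuel.Theorems.ZilberEacParamRamifiedChart
import Summits.Schanuel.Schanuel.Theorems.ZilberEacLindemannNonResonance
import HarnessLib

/-!
# Arbitrary base branches, LXXXV: CONSTANT FIBRES OVER EVERY POLYNOMIAL GRAPH DEFINED OVER `ℚ̄` —
# together with gen 26, Mantova–Masser's question over polynomial graphs over `ℚ̄` is settled

HONEST FRAMING.  Cell `pub-schanuel` (Zilber's Exponential-Algebraic Closedness, case ladder;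
host summit Schanuel), seat 2, gen 32.  Over a polynomial graph `x₁ = p(x₀)`, `deg p ≥ 2`, the only
surfaces of Mantova–Masser's case whose density was undecided were the constant-fibre cylinders
`{x₁ = p(x₀), y₀ = θ}` (gen 26, `mmCase_graphBase_complete`), and among those the resonant ones
(`lc(p)·(2πi)^{deg p} ∈ 2πiℚ`, e.g. `x₁ = x₀²/(2πi)`, NOT dense for `y₀ = 1`).  If `p` has ALGEBRAIC
coefficients, resonance is impossible (`deg p ≥ 2 ≠ 1 = k`, Lindemann, file LXXXII), so:
**`unprojectedDensityQuestion_graph_constFibre_algebraic`** — `p ∈ ℚ̄[x₀]`, `deg p ≥ 2`,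
EVERY `θ ≠ 0`: `{x₁ = p(x₀), y₀ = θ}` is in the case AND dense (growth if `Re(lc·(2πi)^M) ≠ 0`,
Kronecker otherwise: **`unprojectedDense_graph_constFibre_of_not_resonant`**).  Decided instances
of an OPEN question (Mantova–Masser, PLMS 2024 §1 p. 5); EC(3,2) OPEN; NOT Schanuel's conjecture
(neither used nor implied; Lindemann's theorem is); EAC ⇏ SC.
-/

noncomputable section

open Filter Topology Set Complex MvPolynomial
open Literature.NumberTheory.Transcendental Literature.ModelTheory.Zilber
open Literature.ModelTheory.ExponentialFields

set_option linter.dupNamespace false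

namespace Summit.Schanuel.Schanuel.Theorems

/-- `y_i − θ` is irreducible in `ℂ[y₀, y₁]` (total degree one, a unit coefficient). [folklore] -/
theorem irreducible_X_sub_C (i : Fin 2) (θ : ℂ) :
    Irreducible (X i - MvPolynomial.C θ : MvPolynomial (Fin 2) ℂ) := by
  classical
  have hne : (0 : Fin 2 →₀ ℕ) ≠ Finsupp.single i 1 := (Finsupp.single_ne_zero.2 one_ne_zero).symm
  have hcoeff : MvPolynomial.coeff (Finsupp.single i 1)
      (X i - MvPolynomial.C θ : MvPolynomial (Fin 2) ℂ) = 1 := by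
    rw [MvPolynomial.coeff_sub, MvPolynomial.coeff_C, if_neg hne, sub_zero]
    simp
  refine MvPolynomial.irreducible_of_totalDegree_eq_one ?_ ?_
  · refine le_antisymm ((MvPolynomial.totalDegree_sub_C_le _ _).trans
      (by rw [MvPolynomial.totalDegree_X])) ?_
    have hmem : (Finsupp.single i 1) ∈
        (X i - MvPolynomial.C θ : MvPolynomial (Fin 2) ℂ).support := by
      rw [MvPolynomial.mem_support_iff, hcoeff]
      exact one_ne_zero
    have h := MvPolynomial.le_totalDegree hmem
    rwa [Finsupp.sum_single_index rfl] at h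
  · intro x hx
    have h := hx (Finsupp.single i 1)
    rw [hcoeff] at h
    exact isUnit_of_dvd_one h

section Graph

variable (p : Polynomial ℂ)

/-- **Constant fibres over a polynomial graph with NON-RESONANT top phase: dense** (`deg p = M ≥ 1`,
leading coefficient `c`, `Re(c(2πi)^M) ≠ 0` or `Im(c(2πi)^M)/2π ∉ ℚ`; `θ ≠ 0`).
[cite: MantovaMasser2023, §1 Further remarks, p. 5 (the question, open in general)] (new) -/
theorem unprojectedDense_graph_constFibre_of_not_resonant (hd : 1 ≤ p.natDegree)
    (hdir : (p.leadingCoeff * (2 * Real.pi * I) ^ p.natDegree).re ≠ 0 ∨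
      Irrational ((p.leadingCoeff * (2 * Real.pi * I) ^ p.natDegree).im / (2 * Real.pi)))
    {θ : ℂ} (hθ : θ ≠ 0) :
    UnprojectedDense {w : Fin 2 ⊕ Fin 2 → ℂ | w (Sum.inl 1) = p.eval (w (Sum.inl 0)) ∧
      MvPolynomial.eval (fun i => w (Sum.inr i)) (X 0 - MvPolynomial.C θ : MvPolynomial (Fin 2) ℂ) = 0} := by
  have hS := isIrreducibleClosed_graphCurveSurface p (irreducible_X_sub_C 0 θ)
  have hdim := zariskiDim_graphCurveSurface p (irreducible_X_sub_C 0 θ)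
  obtain ⟨U₀, hUan, hU0, hUeval⟩ :=
    exists_polarForm_eval p (U := fun _ : ℂ => (1 : ℂ)) analyticAt_const (k := 1) le_rfl
  rw [one_pow, mul_one] at hU0
  refine unprojectedDense_branch_of_not_resonant hS (le_of_eq hdim) le_rfl hd
    (ψ := fun _ => θ) analyticAt_const hθ rfl hUan ⟨2 * Real.pi * I, pow_one _, ?_⟩ ?_
  · rw [hU0]
    exact hdir
  · filter_upwards [self_mem_nhdsWithin] with s (hs : s ≠ 0)
    refine ⟨?_, ?_⟩
    · simp only [Sum.elim_inl, Matrix.cons_val_one, Matrix.cons_val_zero]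
      have h := hUeval s hs
      rw [one_mul, one_mul, pow_one] at h
      rw [← inv_pow, pow_one, h]
    · simp [Sum.elim_inr]

/-- **Constant fibres over every polynomial graph over `ℚ̄`: case ∧ dense.**  `deg p ≥ 2`, all
coefficients of `p` algebraic over `ℚ`, `θ ≠ 0` ⟹ `{x₁ = p(x₀), y₀ = θ}` is in Mantova–Masser's case
AND has Zariski-dense exponential points: the top phase `lc(p)·(2πi)^{deg p}` is non-resonant because
`lc(p)` is algebraic and `deg p ≠ 1` (Lindemann). [cite: MantovaMasser2023, §1 Further remarks, p. 5
(the question, open in general)] (new) -/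
theorem unprojectedDensityQuestion_graph_constFibre_algebraic (hd : 2 ≤ p.natDegree)
    (halg : ∀ i, IsAlgebraic ℚ (p.coeff i)) {θ : ℂ} (hθ : θ ≠ 0) :
    MMCaseDimPiOneFree {w : Fin 2 ⊕ Fin 2 → ℂ | w (Sum.inl 1) = p.eval (w (Sum.inl 0)) ∧
        w (Sum.inr 0) = θ} ∧
      UnprojectedDense {w : Fin 2 ⊕ Fin 2 → ℂ | w (Sum.inl 1) = p.eval (w (Sum.inl 0)) ∧
        w (Sum.inr 0) = θ} := by
  have e : {w : Fin 2 ⊕ Fin 2 → ℂ | w (Sum.inl 1) = p.eval (w (Sum.inl 0)) ∧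
      MvPolynomial.eval (fun i => w (Sum.inr i)) (X 0 - MvPolynomial.C θ : MvPolynomial (Fin 2) ℂ) = 0}
      = {w : Fin 2 ⊕ Fin 2 → ℂ | w (Sum.inl 1) = p.eval (w (Sum.inl 0)) ∧ w (Sum.inr 0) = θ} := by
    ext w
    simp only [Set.mem_setOf_eq, map_sub, MvPolynomial.eval_X, MvPolynomial.eval_C, sub_eq_zero]
  rw [← e]
  have hp0 : p ≠ 0 := by
    rintro rfl
    rw [Polynomial.natDegree_zero] at hd
    omega
  have hlc : IsAlgebraic ℚ p.leadingCoeff := halg _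
  have hlc0 : p.leadingCoeff ≠ 0 := Polynomial.leadingCoeff_ne_zero.2 hp0
  have hdir := not_resonant_of_isAlgebraic hlc hlc0 (k := 1) (M := p.natDegree) le_rfl (by omega)
    (z := 2 * Real.pi * I) (pow_one _)
  refine ⟨mmCase_graphCurveSurface p hd (irreducible_X_sub_C 0 θ)
    ((graphCurveSurface_inter_torusLocus_nonempty_iff p _).2 ⟨![θ, 1], by simpa using hθ, by simp,
      by simp⟩), unprojectedDense_graph_constFibre_of_not_resonant p (by omega) hdir hθ⟩

/-- **Rational coefficients.** [cite: MantovaMasser2023, §1 Further remarks, p. 5 (the question, open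
in general)] (new) -/
theorem unprojectedDensityQuestion_graph_constFibre_ratCoeff (hd : 2 ≤ p.natDegree)
    (c : ℕ → ℚ) (hc : ∀ i, p.coeff i = (c i : ℂ)) {θ : ℂ} (hθ : θ ≠ 0) :
    MMCaseDimPiOneFree {w : Fin 2 ⊕ Fin 2 → ℂ | w (Sum.inl 1) = p.eval (w (Sum.inl 0)) ∧
        w (Sum.inr 0) = θ} ∧
      UnprojectedDense {w : Fin 2 ⊕ Fin 2 → ℂ | w (Sum.inl 1) = p.eval (w (Sum.inl 0)) ∧
        w (Sum.inr 0) = θ} :=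
  unprojectedDensityQuestion_graph_constFibre_algebraic p hd
    (fun i => by rw [hc]; exact isAlgebraic_algebraMap (c i)) hθ

/-- Example: `{x₁ = x₀² + x₀, y₀ = θ}` — case ∧ dense for every `θ ≠ 0` (even degree: a good
direction; recorded as an instance of the `ℚ̄` statement). [cite: MantovaMasser2023, §1 Further
remarks, p. 5 (the question, open in general)] (new) -/
theorem unprojectedDensityQuestion_quadraticGraph_constFibre {θ : ℂ} (hθ : θ ≠ 0) :
    MMCaseDimPiOneFree {w : Fin 2 ⊕ Fin 2 → ℂ | w (Sum.inl 1) = w (Sum.inl 0) ^ 2 + w (Sum.inl 0) ∧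
        w (Sum.inr 0) = θ} ∧
      UnprojectedDense {w : Fin 2 ⊕ Fin 2 → ℂ | w (Sum.inl 1) = w (Sum.inl 0) ^ 2 + w (Sum.inl 0) ∧
        w (Sum.inr 0) = θ} := by
  have hdeg : (Polynomial.X ^ 2 + Polynomial.X : Polynomial ℂ).natDegree = 2 := by compute_degree!
  have h := unprojectedDensityQuestion_graph_constFibre_ratCoeff (Polynomial.X ^ 2 + Polynomial.X)
    (by rw [hdeg]) (fun i => if i = 2 then 1 else if i = 1 then 1 else 0) (fun i => by
      rw [Polynomial.coeff_add, Polynomial.coeff_X_pow, Polynomial.coeff_X]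
      rcases i with _ | _ | _ | i <;> simp) hθ
  simpa only [Polynomial.eval_add, Polynomial.eval_pow, Polynomial.eval_X] using h

end Graph

end Summit.Schanuel.Schanuel.Theorems

end
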